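import Mathlib.Topology.Algebra.InfiniteSum.Constructions
import Mathlib.Topology.Algebra.InfiniteSum.ENNReal
import Summits.CriticalPhenomena.SAWScalingLimit.Theorems.SAWTotalPositivityBoundaryTP2Defs
import Summits.CriticalPhenomena.SAWScalingLimit.Theorems.SAWTotalPositivityBoundaryTP2Strip4RecPair301Aux
import Summits.CriticalPhenomena.SAWScalingLimit.Theorems.EdgeOfPositivity.Negative.EdgeOfPositivityRectDomain
import HarnessLib

/-!
# Crux `BoundaryTP2` (stmt-CriticalPhenomena-7115), line `Sketch`: width-4 pair recursion `301`

Tool stub `stub_strip4_recPair301` (W4-C4). On `S_L = discreteDomainGraph (rectDomain L 3) 1` (sites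
`{0..L} × {0,1,2,3}`), with rows labelled `ρ = (r0,r1,r2,r3) = (0,1,2,3)` or `(3,2,1,0)`, start
`a = (0,r)`, `Z(s) = Z_{S_L}(a,(L,s))` and the disjoint-pair kernels
`PP(s; u→v) = Σ x^{|γ|+|γ'|}` over the vertex-disjoint pairs `γ : a → (L,s)`, `γ' : (L,u) → (L,v)`
of `S_L`, the pair kernel of `S_{L+1}` with main path to `(L+1,r3)` and loop `(L+1,r0) → (L+1,r1)`
equals

  `x³ Z(r2) + x² Z(r3) + x⁴ PP(r2; r0→r1) + x³ PP(r3; r0→r1) + x⁴ PP(r3; r0→r2)`.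

Proof. Write `m_j = (L+1,r_j)`, `p_j = (L,r_j)`. In a disjoint pair the loop `γ'` avoids `m₃ ∈ γ`,
so it is the rung `m₀ m₁`, or `m₀ p₀ · δ · p₁ m₁` with `δ : p₀ → p₁` in `S_L` (`m₂` would be a dead
end on `δ`), or `m₀ p₀ · δ · p₂ m₂ m₁` with `δ : p₀ → p₂` in `S_L`; and `γ` avoids `m₀, m₁ ∈ γ'`, so
it is `γ₀ · p₃ m₃` (`γ₀ : a → p₃` in `S_L`, `m₂` a dead end) or `γ₀ · p₂ m₂ m₃` (`γ₀ : a → p₂` in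
`S_L`).
These gluing maps (`…Strip4RecPair301Aux`) are injective with every disjoint pair in the range of
their product, so the sum is transported (`Function.Injective.tsum_eq`) and split over the
`2 × 3` classes (`Summable.tsum_sum`): the rung classes give `x² Z(r3)`, `x³ Z(r2)`, the dip classes
`x³ PP(r3; r0→r1)`, `x⁴ PP(r2; r0→r1)`, `x⁴ PP(r3; r0→r2)`, and the class
`(γ₀ · p₂ m₂ m₃, ⋯ m₂ m₁)` is never disjoint (`s4r301_abstract`). The strip instance is coordinate
bookkeeping on `Site 2` closed by `omega`, uniformly in the two row labellings.
-/

noncomputable section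

namespace Summit.CriticalPhenomena.SAWScalingLimit.Theorems.BoundaryTP2

open SimpleGraph Walk
open Literature.Probability.LatticeModels Literature.Probability.RandomPlanarGeometry
open Summit.CriticalPhenomena.SAWScalingLimit.Theorems.EdgeOfPositivity.Negative
open scoped ENNReal

variable {V : Type*}

/-! ## Weights of glued pairs -/

/-- Disjointness of two glued supports: old parts `l₁`, `l₂` (in `P`), new parts `n₁`, `m₀ :: n₂`
(off `P`). [folklore] -/
private theorem s4r301_disjoint_iff {P : V → Prop} {m₀ : V} (hm₀ : ¬ P m₀) {l₁ l₂ n₁ n₂ : List V}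
    (hl₁ : ∀ z ∈ l₁, P z) (hl₂ : ∀ z ∈ l₂, P z) (hn₁ : ∀ z ∈ n₁, ¬ P z) (hn₂ : ∀ z ∈ n₂, ¬ P z) :
    List.Disjoint (l₁ ++ n₁) (m₀ :: (l₂ ++ n₂)) ↔
      List.Disjoint l₁ l₂ ∧ List.Disjoint n₁ (m₀ :: n₂) := by
  rw [List.disjoint_cons_right, List.disjoint_append_right, List.disjoint_append_left,
    List.disjoint_append_left, List.disjoint_cons_right, List.mem_append, not_or]
  exact ⟨fun h => ⟨h.2.1.1, h.1.2, h.2.2.2⟩, fun h => ⟨⟨fun h' => hm₀ (hl₁ _ h'), h.2.1⟩,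
    ⟨h.1, fun z hz hz' => hn₁ z hz (hl₂ z hz')⟩, fun z hz hz' => hn₂ z hz' (hl₁ z hz), h.2.2⟩⟩

open Classical in
/-- Weight of a glued pair in terms of the weight of its old parts. [folklore] -/
private theorem s4r301_term {x : ℝ} (hx : 0 ≤ x) {P : V → Prop} {m₀ : V} (hm₀ : ¬ P m₀)
    (n₁ n₂ : List V) (hn₁ : ∀ z ∈ n₁, ¬ P z) (hn₂ : ∀ z ∈ n₂, ¬ P z)
    (hn : List.Disjoint n₁ (m₀ :: n₂)) {i j c : ℕ} (hc : i + j = c) {l₁ l₂ : List V}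
    (hl₁ : ∀ z ∈ l₁, P z) (hl₂ : ∀ z ∈ l₂, P z) (k₁ k₂ : ℕ) :
    (if List.Disjoint (l₁ ++ n₁) (m₀ :: (l₂ ++ n₂)) then
        ENNReal.ofReal (x ^ (k₁ + i)) * ENNReal.ofReal (x ^ (k₂ + j)) else 0) =
      ENNReal.ofReal (x ^ c) * (if List.Disjoint l₁ l₂ then
        ENNReal.ofReal (x ^ k₁) * ENNReal.ofReal (x ^ k₂) else 0) := by
  by_cases h : List.Disjoint l₁ l₂
  · rw [if_pos ((s4r301_disjoint_iff hm₀ hl₁ hl₂ hn₁ hn₂).2 ⟨h, hn⟩), if_pos h,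
      ← ENNReal.ofReal_mul (pow_nonneg hx _), ← ENNReal.ofReal_mul (pow_nonneg hx _),
      ← ENNReal.ofReal_mul (pow_nonneg hx _), ← pow_add, ← pow_add, ← pow_add, ← hc]
    congr 2
    omega
  · rw [if_neg (fun h' => h ((s4r301_disjoint_iff hm₀ hl₁ hl₂ hn₁ hn₂).1 h').1), if_neg h,
      mul_zero]

open Classical in
/-- Weight of a glued pair whose loop is the rung `m₀ m₁`. [folklore] -/
private theorem s4r301_termU {x : ℝ} (hx : 0 ≤ x) {P : V → Prop} {m₀ m₁ : V} (hm₀ : ¬ P m₀)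
    (hm₁ : ¬ P m₁) (n₁ : List V) (hn : List.Disjoint n₁ [m₀, m₁]) {i c : ℕ} (hc : i + 1 = c)
    {l₁ : List V} (hl₁ : ∀ z ∈ l₁, P z) (k : ℕ) :
    (if List.Disjoint (l₁ ++ n₁) [m₀, m₁] then
        ENNReal.ofReal (x ^ (k + i)) * ENNReal.ofReal (x ^ 1) else 0) =
      ENNReal.ofReal (x ^ c) * ENNReal.ofReal (x ^ k) := by
  rw [if_pos, ← ENNReal.ofReal_mul (pow_nonneg hx _), ← ENNReal.ofReal_mul (pow_nonneg hx _),
    ← pow_add, ← pow_add, ← hc]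
  · congr 2
    omega
  · rw [List.disjoint_append_left]
    refine ⟨fun z hz hz' => ?_, hn⟩
    rw [List.mem_cons, List.mem_singleton] at hz'
    rcases hz' with rfl | rfl
    exacts [hm₀ (hl₁ _ hz), hm₁ (hl₁ _ hz)]

/-- Two glued supports sharing the new vertex `m` are not disjoint. [folklore] -/
private theorem s4r301_term0 {m₀ m : V} {n₁ n₂ : List V} (h₁ : m ∈ n₁) (h₂ : m ∈ n₂)
    (l₁ l₂ : List V) (w : ℝ≥0∞) [Decidable (List.Disjoint (l₁ ++ n₁) (m₀ :: (l₂ ++ n₂)))] :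
    (if List.Disjoint (l₁ ++ n₁) (m₀ :: (l₂ ++ n₂)) then w else 0) = 0 :=
  if_neg fun h => h (List.mem_append_right _ h₁)
    (List.mem_cons_of_mem _ (List.mem_append_right _ h₂))


/-! ## The recursion, abstract form -/

open Classical in
/-- **The pair recursion `301`, abstract form.** `G₀ ≤ G` on one vertex type; `G` is `G₀` plus a
pendant column `m₀ m₁ m₂ m₃` hung on `p₀ p₁ p₂ p₃` (`N(m₀) ⊆ {p₀,m₁}`, `N(m₁) ⊆ {p₁,m₀,m₂}`,
`N(m₂) ⊆ {p₂,m₁,m₃}`, `N(m₃) ⊆ {p₃,m₂}`, the listed rungs and column edges present, the edges of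
`G` between old vertices in `G₀`, the edges of `G₀` between old vertices). Then for `x ≥ 0` the
disjoint-pair sum over `(γ : a → m₃, γ' : m₀ → m₁)` of `G` equals
`x³ Z_{G₀}(a,p₂) + x² Z_{G₀}(a,p₃) + x⁴ PP(a→p₂; p₀→p₁) + x³ PP(a→p₃; p₀→p₁) + x⁴ PP(a→p₃; p₀→p₂)`:
reparametrise the disjoint pairs by the two gluing maps and split the sum over the classes.
[folklore] -/
private theorem s4r301_abstract {G₀ G : SimpleGraph V} {a p₀ p₁ p₂ p₃ m₀ m₁ m₂ m₃ : V} (x : ℝ)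
    (hx : 0 ≤ x) (hle : G₀ ≤ G)
    (hold : ∀ u v, G.Adj u v → (u ≠ m₀ ∧ u ≠ m₁ ∧ u ≠ m₂ ∧ u ≠ m₃) →
      (v ≠ m₀ ∧ v ≠ m₁ ∧ v ≠ m₂ ∧ v ≠ m₃) → G₀.Adj u v)
    (hG₀ : ∀ u v, G₀.Adj u v → v ≠ m₀ ∧ v ≠ m₁ ∧ v ≠ m₂ ∧ v ≠ m₃)
    (ha : a ≠ m₀ ∧ a ≠ m₁ ∧ a ≠ m₂ ∧ a ≠ m₃) (hp₀ : p₀ ≠ m₀ ∧ p₀ ≠ m₁ ∧ p₀ ≠ m₂ ∧ p₀ ≠ m₃)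
    (hp₁ : p₁ ≠ m₀ ∧ p₁ ≠ m₁ ∧ p₁ ≠ m₂ ∧ p₁ ≠ m₃) (hp₃ : p₃ ≠ m₀ ∧ p₃ ≠ m₁ ∧ p₃ ≠ m₂ ∧ p₃ ≠ m₃)
    (h33 : G.Adj p₃ m₃) (h22 : G.Adj p₂ m₂) (hm23 : G.Adj m₂ m₃) (h01 : G.Adj m₀ m₁)
    (h00 : G.Adj m₀ p₀) (h11 : G.Adj p₁ m₁) (hm21 : G.Adj m₂ m₁)
    (hN0 : ∀ u, G.Adj m₀ u → u = p₀ ∨ u = m₁) (hN1 : ∀ u, G.Adj m₁ u → u = p₁ ∨ u = m₀ ∨ u = m₂)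
    (hN2 : ∀ u, G.Adj m₂ u → u = p₂ ∨ u = m₁ ∨ u = m₃) (hN3 : ∀ u, G.Adj m₃ u → u = p₃ ∨ u = m₂)
    (hm02 : m₀ ≠ m₂) (hm03 : m₀ ≠ m₃) (hm13 : m₁ ≠ m₃) :
    (∑' (γ : G.Path a m₃) (γ' : G.Path m₀ m₁),
      (if List.Disjoint γ.1.support γ'.1.support then
        ENNReal.ofReal (x ^ γ.1.length) * ENNReal.ofReal (x ^ γ'.1.length) else 0)) =
      ENNReal.ofReal (x ^ 3) * pathKernel G₀ x a p₂ +
        ENNReal.ofReal (x ^ 2) * pathKernel G₀ x a p₃ +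
        ENNReal.ofReal (x ^ 4) *
          (∑' (γ : G₀.Path a p₂) (γ' : G₀.Path p₀ p₁),
            (if List.Disjoint γ.1.support γ'.1.support then
              ENNReal.ofReal (x ^ γ.1.length) * ENNReal.ofReal (x ^ γ'.1.length) else 0)) +
        ENNReal.ofReal (x ^ 3) *
          (∑' (γ : G₀.Path a p₃) (γ' : G₀.Path p₀ p₁),
            (if List.Disjoint γ.1.support γ'.1.support then
              ENNReal.ofReal (x ^ γ.1.length) * ENNReal.ofReal (x ^ γ'.1.length) else 0)) +
        ENNReal.ofReal (x ^ 4) *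
          (∑' (γ : G₀.Path a p₃) (γ' : G₀.Path p₀ p₂),
            (if List.Disjoint γ.1.support γ'.1.support then
              ENNReal.ofReal (x ^ γ.1.length) * ENNReal.ofReal (x ^ γ'.1.length) else 0)) := by
  obtain ⟨e₁, he₁, hr₁, hAs, hAl, hBs, hBl⟩ :=
    s4r301_glueA hle hold hG₀ ha hp₃ h33 h22 hm23 hN3 hN2
  obtain ⟨e₂, he₂, hr₂, hUs, hUl, hCs, hCl, hDs, hDl⟩ :=
    s4r301_glueB hle hold hG₀ hp₀ hp₁ h01 h00 h11 h22 hm21 hm02 hN0 hN1 hN2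
  have hPa : ∀ {u : V} (w : G₀.Walk a u) (z : V), z ∈ w.support →
      z ≠ m₀ ∧ z ≠ m₁ ∧ z ≠ m₂ ∧ z ≠ m₃ :=
    fun w => s4r301_forall_mem_support (P := fun z => z ≠ m₀ ∧ z ≠ m₁ ∧ z ≠ m₂ ∧ z ≠ m₃) hG₀ w ha
  have hPp : ∀ {u : V} (w : G₀.Walk p₀ u) (z : V), z ∈ w.support →
      z ≠ m₀ ∧ z ≠ m₁ ∧ z ≠ m₂ ∧ z ≠ m₃ :=
    fun w => s4r301_forall_mem_support (P := fun z => z ≠ m₀ ∧ z ≠ m₁ ∧ z ≠ m₂ ∧ z ≠ m₃) hG₀ w hp₀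
  -- reparametrise the (disjoint) pairs by the gluing maps
  have h1 : (∑' (γ : G.Path a m₃) (γ' : G.Path m₀ m₁),
      (if List.Disjoint γ.1.support γ'.1.support then
        ENNReal.ofReal (x ^ γ.1.length) * ENNReal.ofReal (x ^ γ'.1.length) else 0)) =
      ∑' (s₁ : G₀.Path a p₃ ⊕ G₀.Path a p₂) (s₂ : Unit ⊕ (G₀.Path p₀ p₁ ⊕ G₀.Path p₀ p₂)),
        (if List.Disjoint (e₁ s₁).1.support (e₂ s₂).1.support then
          ENNReal.ofReal (x ^ (e₁ s₁).1.length) * ENNReal.ofReal (x ^ (e₂ s₂).1.length)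
          else 0) := by
    rw [← ENNReal.tsum_prod, ← ENNReal.tsum_prod]
    refine (Function.Injective.tsum_eq (g := fun s => (e₁ s.1, e₂ s.2))
      (fun s t h => Prod.ext (he₁ (congrArg Prod.fst h)) (he₂ (congrArg Prod.snd h)))
      (f := fun q : G.Path a m₃ × G.Path m₀ m₁ => if List.Disjoint q.1.1.support q.2.1.support then
        ENNReal.ofReal (x ^ q.1.1.length) * ENNReal.ofReal (x ^ q.2.1.length) else 0) ?_).symm
    intro q hq
    rw [Function.mem_support] at hq
    have hd : List.Disjoint q.1.1.support q.2.1.support := by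
      by_contra h
      exact hq (if_neg h)
    obtain ⟨s₁, hs₁⟩ := hr₁ q.1 (fun h => hd h q.2.1.start_mem_support)
      (fun h => hd h q.2.1.end_mem_support)
    obtain ⟨s₂, hs₂⟩ := hr₂ q.2 (fun h => hd q.1.1.end_mem_support h)
    exact ⟨(s₁, s₂), Prod.ext hs₁ hs₂⟩
  have hsplit : ∀ f : Unit ⊕ (G₀.Path p₀ p₁ ⊕ G₀.Path p₀ p₂) → ℝ≥0∞, ∑' s, f s =
      f (Sum.inl ()) + (∑' δ, f (Sum.inr (Sum.inl δ)) + ∑' δ, f (Sum.inr (Sum.inr δ))) := by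
    intro f
    rw [Summable.tsum_sum ENNReal.summable ENNReal.summable,
      Summable.tsum_sum ENNReal.summable ENNReal.summable, tsum_fintype, Fintype.sum_unique]
  have hn0 : ¬ (m₀ ≠ m₀ ∧ m₀ ≠ m₁ ∧ m₀ ≠ m₂ ∧ m₀ ≠ m₃) := fun h => h.1 rfl
  have hn1 : ¬ (m₁ ≠ m₀ ∧ m₁ ≠ m₁ ∧ m₁ ≠ m₂ ∧ m₁ ≠ m₃) := fun h => h.2.1 rfl
  -- the weights of the glued pairs, class by class
  have hT : ∀ (n₁ n₂ : List V), (∀ z ∈ n₁, ¬ (z ≠ m₀ ∧ z ≠ m₁ ∧ z ≠ m₂ ∧ z ≠ m₃)) →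
      (∀ z ∈ n₂, ¬ (z ≠ m₀ ∧ z ≠ m₁ ∧ z ≠ m₂ ∧ z ≠ m₃)) → List.Disjoint n₁ (m₀ :: n₂) →
      ∀ {i j c : ℕ}, i + j = c → ∀ {p p' : V} (γ₀ : G₀.Path a p) (δ : G₀.Path p₀ p'),
      (if List.Disjoint (γ₀.1.support ++ n₁) (m₀ :: (δ.1.support ++ n₂)) then
          ENNReal.ofReal (x ^ (γ₀.1.length + i)) * ENNReal.ofReal (x ^ (δ.1.length + j)) else 0) =
        ENNReal.ofReal (x ^ c) * (if List.Disjoint γ₀.1.support δ.1.support then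
          ENNReal.ofReal (x ^ γ₀.1.length) * ENNReal.ofReal (x ^ δ.1.length) else 0) :=
    fun n₁ n₂ hn₁ hn₂ hn _ _ _ hc _ _ γ₀ δ =>
      s4r301_term (P := fun z => z ≠ m₀ ∧ z ≠ m₁ ∧ z ≠ m₂ ∧ z ≠ m₃) hx hn0 n₁ n₂ hn₁ hn₂ hn hc
        (hPa γ₀.1) (hPp δ.1) _ _
  have hTU : ∀ n₁ : List V, List.Disjoint n₁ [m₀, m₁] → ∀ {i c : ℕ}, i + 1 = c →
      ∀ {p : V} (γ₀ : G₀.Path a p),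
      (if List.Disjoint (γ₀.1.support ++ n₁) [m₀, m₁] then
          ENNReal.ofReal (x ^ (γ₀.1.length + i)) * ENNReal.ofReal (x ^ 1) else 0) =
        ENNReal.ofReal (x ^ c) * ENNReal.ofReal (x ^ γ₀.1.length) :=
    fun n₁ hn _ _ hc _ γ₀ =>
      s4r301_termU (P := fun z => z ≠ m₀ ∧ z ≠ m₁ ∧ z ≠ m₂ ∧ z ≠ m₃) hx hn0 hn1 n₁ hn hc
        (hPa γ₀.1) _
  -- the new parts of the glued supports are pairwise disjoint
  have h3 : m₃ ∉ [m₀, m₁] := fun h => by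
    rcases List.mem_cons.1 h with h | h
    exacts [hm03 h.symm, hm13 (List.mem_singleton.1 h).symm]
  have h2 : m₂ ∉ [m₀, m₁] := fun h => by
    rcases List.mem_cons.1 h with h | h
    exacts [hm02 h.symm, hm21.ne (List.mem_singleton.1 h)]
  have h3' : m₃ ∉ [m₀, m₂, m₁] := fun h => by
    rcases List.mem_cons.1 h with h | h
    · exact hm03 h.symm
    rcases List.mem_cons.1 h with h | h
    exacts [hm23.ne h.symm, hm13 (List.mem_singleton.1 h).symm]
  have hd3 : List.Disjoint [m₃] [m₀, m₁] := List.singleton_disjoint.2 h3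
  have hd23 : List.Disjoint [m₂, m₃] [m₀, m₁] := List.disjoint_cons_left.2 ⟨h2, hd3⟩
  have hd3' : List.Disjoint [m₃] [m₀, m₂, m₁] := List.singleton_disjoint.2 h3'
  rw [h1, Summable.tsum_sum ENNReal.summable ENNReal.summable]
  simp only [hsplit, hAs, hAl, hBs, hBl, hUs, hUl, hCs, hCl, hDs, hDl]
  simp only [hTU [m₃] hd3 (rfl : 1 + 1 = 2), hTU [m₂, m₃] hd23 (rfl : 2 + 1 = 3),
    hT [m₃] [m₁] (by simp) (by simp) hd3 (rfl : 1 + 2 = 3),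
    hT [m₂, m₃] [m₁] (by simp) (by simp) hd23 (rfl : 2 + 2 = 4),
    hT [m₃] [m₂, m₁] (by simp) (by simp) hd3' (rfl : 1 + 3 = 4),
    s4r301_term0 (m₀ := m₀) (n₁ := [m₂, m₃]) (n₂ := [m₂, m₁]) (m := m₂) (by simp) (by simp),
    tsum_zero, add_zero, ENNReal.tsum_add, ENNReal.tsum_mul_left]
  simp only [pathKernel]
  ring

/-! ## The strip instance -/

/-- Adjacency in `ℤ²` in coordinates. [folklore] -/
private theorem s4r301_zd_adj_iff (u v : Site 2) :
    (zdGraph 2).Adj u v ↔ ((v 0 = u 0 + 1 ∨ u 0 = v 0 + 1) ∧ v 1 = u 1) ∨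
      ((v 1 = u 1 + 1 ∨ u 1 = v 1 + 1) ∧ v 0 = u 0) := by
  -- adapted from `s3p_zd_adj_iff` in `…BoundaryTP2Strip3RecPair`
  rw [zdGraph_adj_iff, Fin.exists_fin_two]
  simp only [funext_iff, Fin.forall_fin_two, Pi.add_apply, Pi.single_eq_same,
    Pi.single_eq_of_ne (one_ne_zero : (1 : Fin 2) ≠ 0),
    Pi.single_eq_of_ne (zero_ne_one : (0 : Fin 2) ≠ 1), add_zero]
  omega

/-- A site equals `st a b` iff its two coordinates are `a` and `b`. [folklore] -/
private theorem s4r301_eq_st_iff (v : Site 2) (a b : ℤ) : v = st a b ↔ v 0 = a ∧ v 1 = b :=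
  ⟨fun h => h ▸ ⟨rfl, rfl⟩, fun h => by rw [← st_eta v, h.1, h.2]⟩

/-- Adjacency of the strip `{0..n} × {0,1,2,3}` in coordinates. [folklore] -/
private theorem s4r301_adj_iff (n : ℕ) (u v : Site 2) :
    (discreteDomainGraph (rectDomain n 3) 1).Adj u v ↔
      (((v 0 = u 0 + 1 ∨ u 0 = v 0 + 1) ∧ v 1 = u 1) ∨
          ((v 1 = u 1 + 1 ∨ u 1 = v 1 + 1) ∧ v 0 = u 0)) ∧
        ((0 ≤ u 0 ∧ u 0 ≤ n) ∧ (0 ≤ u 1 ∧ u 1 ≤ 3)) ∧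
          ((0 ≤ v 0 ∧ v 0 ≤ n) ∧ (0 ≤ v 1 ∧ v 1 ≤ 3)) := by
  rw [adj_rect_iff, s4r301_zd_adj_iff, mem_rectSites_iff, mem_rectSites_iff, Nat.cast_ofNat]

/-- The sites of `S_L` are the sites of `S_{L+1}` off the new column `L+1` (whose rows are
`r0, r1, r2, r3`). [folklore] -/
private theorem s4r301_mem_old_iff (L : ℕ) (r0 r1 r2 r3 : ℤ)
    (hρ : (r0 = 0 ∧ r1 = 1 ∧ r2 = 2 ∧ r3 = 3) ∨ (r0 = 3 ∧ r1 = 2 ∧ r2 = 1 ∧ r3 = 0)) (u : Site 2) :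
    u ∈ rectSites L 3 ↔ u ∈ rectSites (L + 1) 3 ∧ (u ≠ st (L + 1 : ℕ) r0 ∧ u ≠ st (L + 1 : ℕ) r1 ∧
      u ≠ st (L + 1 : ℕ) r2 ∧ u ≠ st (L + 1 : ℕ) r3) := by
  rw [mem_rectSites_iff, mem_rectSites_iff, Ne, Ne, Ne, Ne, s4r301_eq_st_iff, s4r301_eq_st_iff,
    s4r301_eq_st_iff, s4r301_eq_st_iff]
  omega

/-- The seven edges of `S_{L+1}` at its last column used by the recursion, and distinctness of the
new sites. [folklore] -/
private theorem s4r301_column (L : ℕ) (r0 r1 r2 r3 : ℤ)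
    (hρ : (r0 = 0 ∧ r1 = 1 ∧ r2 = 2 ∧ r3 = 3) ∨ (r0 = 3 ∧ r1 = 2 ∧ r2 = 1 ∧ r3 = 0)) :
    ((discreteDomainGraph (rectDomain (L + 1) 3) 1).Adj (st L r3) (st (L + 1 : ℕ) r3) ∧
      (discreteDomainGraph (rectDomain (L + 1) 3) 1).Adj (st L r2) (st (L + 1 : ℕ) r2) ∧
      (discreteDomainGraph (rectDomain (L + 1) 3) 1).Adj (st (L + 1 : ℕ) r2) (st (L + 1 : ℕ) r3) ∧
      (discreteDomainGraph (rectDomain (L + 1) 3) 1).Adj (st (L + 1 : ℕ) r0) (st (L + 1 : ℕ) r1) ∧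
      (discreteDomainGraph (rectDomain (L + 1) 3) 1).Adj (st (L + 1 : ℕ) r0) (st L r0) ∧
      (discreteDomainGraph (rectDomain (L + 1) 3) 1).Adj (st L r1) (st (L + 1 : ℕ) r1) ∧
      (discreteDomainGraph (rectDomain (L + 1) 3) 1).Adj (st (L + 1 : ℕ) r2) (st (L + 1 : ℕ) r1)) ∧
    (st (L + 1 : ℕ) r0 ≠ st (L + 1 : ℕ) r2 ∧ st (L + 1 : ℕ) r0 ≠ st (L + 1 : ℕ) r3 ∧
      st (L + 1 : ℕ) r1 ≠ st (L + 1 : ℕ) r3) := by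
  refine ⟨?_, ?_⟩
  · refine ⟨?_, ?_, ?_, ?_, ?_, ?_, ?_⟩ <;>
      (rw [s4r301_adj_iff]; dsimp only [st_zero, st_one]; omega)
  · rw [Ne, Ne, Ne, s4r301_eq_st_iff, s4r301_eq_st_iff, s4r301_eq_st_iff]
    dsimp only [st_zero, st_one]
    omega

/-- The neighbours, in `S_{L+1}`, of the four sites of its last column. [folklore] -/
private theorem s4r301_nbrs (L : ℕ) (r0 r1 r2 r3 : ℤ)
    (hρ : (r0 = 0 ∧ r1 = 1 ∧ r2 = 2 ∧ r3 = 3) ∨ (r0 = 3 ∧ r1 = 2 ∧ r2 = 1 ∧ r3 = 0)) :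
    (∀ u, (discreteDomainGraph (rectDomain (L + 1) 3) 1).Adj (st (L + 1 : ℕ) r0) u →
        u = st L r0 ∨ u = st (L + 1 : ℕ) r1) ∧
      (∀ u, (discreteDomainGraph (rectDomain (L + 1) 3) 1).Adj (st (L + 1 : ℕ) r1) u →
        u = st L r1 ∨ u = st (L + 1 : ℕ) r0 ∨ u = st (L + 1 : ℕ) r2) ∧
      (∀ u, (discreteDomainGraph (rectDomain (L + 1) 3) 1).Adj (st (L + 1 : ℕ) r2) u →
        u = st L r2 ∨ u = st (L + 1 : ℕ) r1 ∨ u = st (L + 1 : ℕ) r3) ∧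
      (∀ u, (discreteDomainGraph (rectDomain (L + 1) 3) 1).Adj (st (L + 1 : ℕ) r3) u →
        u = st L r3 ∨ u = st (L + 1 : ℕ) r2) := by
  refine ⟨fun u h => ?_, fun u h => ?_, fun u h => ?_, fun u h => ?_⟩ <;>
    (rw [s4r301_adj_iff] at h; simp only [s4r301_eq_st_iff]; dsimp only [st_zero, st_one] at h;
      omega)

open Classical in
/-- STUB W4-C4 (`stub_strip4_recPair301`). Recursion of the disjoint-pair kernel (main path to
`(L+1,ρ₃)`, loop `(L+1,ρ₀) → (L+1,ρ₁)`): the loop is the rung (then the main path enters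
`(L+1,ρ₃)` from `(L,ρ₃)` after a path of `S_L`, or through `(L,ρ₂) (L+1,ρ₂)`), or it dips
`(L+1,ρ₀) (L,ρ₀) ⋯ (L,ρ₁) (L+1,ρ₁)` (main path as before, disjoint from the dip) or
`(L+1,ρ₀) (L,ρ₀) ⋯ (L,ρ₂) (L+1,ρ₂) (L+1,ρ₁)` (main path from `(L,ρ₃)`); a path cannot pass
through the new site `(L+1,ρ₂)` when two of its three neighbours are taken (dead end). Instance of
`s4r301_abstract`. [folklore] -/
theorem stub_strip4_recPair301 (L : ℕ) {x : ℝ} (hx : 0 ≤ x) (r : ℤ) (hr : 0 ≤ r ∧ r ≤ 3) (r0 r1 r2 r3 : ℤ)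
    (hρ : (r0 = 0 ∧ r1 = 1 ∧ r2 = 2 ∧ r3 = 3) ∨ (r0 = 3 ∧ r1 = 2 ∧ r2 = 1 ∧ r3 = 0)) :
    (∑' (γ : (discreteDomainGraph (rectDomain (L + 1) 3) 1).Path (st 0 r) (st (L + 1 : ℕ) r3))
        (γ' : (discreteDomainGraph (rectDomain (L + 1) 3) 1).Path (st (L + 1 : ℕ) r0) (st (L + 1 : ℕ) r1)),
      (if List.Disjoint γ.1.support γ'.1.support then
        ENNReal.ofReal (x ^ γ.1.length) * ENNReal.ofReal (x ^ γ'.1.length) else 0)) =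
      ENNReal.ofReal (x ^ 3) * pathKernel (discreteDomainGraph (rectDomain L 3) 1) x (st 0 r) (st L r2) +
        ENNReal.ofReal (x ^ 2) * pathKernel (discreteDomainGraph (rectDomain L 3) 1) x (st 0 r) (st L r3) +
        ENNReal.ofReal (x ^ 4) *
          (∑' (γ : (discreteDomainGraph (rectDomain L 3) 1).Path (st 0 r) (st L r2))
              (γ' : (discreteDomainGraph (rectDomain L 3) 1).Path (st L r0) (st L r1)),
            (if List.Disjoint γ.1.support γ'.1.support then
              ENNReal.ofReal (x ^ γ.1.length) * ENNReal.ofReal (x ^ γ'.1.length) else 0)) +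
        ENNReal.ofReal (x ^ 3) *
          (∑' (γ : (discreteDomainGraph (rectDomain L 3) 1).Path (st 0 r) (st L r3))
              (γ' : (discreteDomainGraph (rectDomain L 3) 1).Path (st L r0) (st L r1)),
            (if List.Disjoint γ.1.support γ'.1.support then
              ENNReal.ofReal (x ^ γ.1.length) * ENNReal.ofReal (x ^ γ'.1.length) else 0)) +
        ENNReal.ofReal (x ^ 4) *
          (∑' (γ : (discreteDomainGraph (rectDomain L 3) 1).Path (st 0 r) (st L r3))
              (γ' : (discreteDomainGraph (rectDomain L 3) 1).Path (st L r0) (st L r2)),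
            (if List.Disjoint γ.1.support γ'.1.support then
              ENNReal.ofReal (x ^ γ.1.length) * ENNReal.ofReal (x ^ γ'.1.length) else 0)) := by
  obtain ⟨⟨h33, h22, hm23, h01, h00, h11, hm21⟩, hm02, hm03, hm13⟩ := s4r301_column L r0 r1 r2 r3 hρ
  obtain ⟨hN0, hN1, hN2, hN3⟩ := s4r301_nbrs L r0 r1 r2 r3 hρ
  have hmo := s4r301_mem_old_iff L r0 r1 r2 r3 hρ
  have ha : st 0 r ∈ rectSites L 3 := by rw [mem_rectSites_iff, st_zero, st_one]; omega
  have hp0 : st (L : ℤ) r0 ∈ rectSites L 3 := by rw [mem_rectSites_iff, st_zero, st_one]; omega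
  have hp1 : st (L : ℤ) r1 ∈ rectSites L 3 := by rw [mem_rectSites_iff, st_zero, st_one]; omega
  have hp3 : st (L : ℤ) r3 ∈ rectSites L 3 := by rw [mem_rectSites_iff, st_zero, st_one]; omega
  exact s4r301_abstract x hx
    (fun u v h => by
      rw [adj_rect_iff] at h ⊢
      exact ⟨h.1, ((hmo u).1 h.2.1).1, ((hmo v).1 h.2.2).1⟩)
    (fun u v h hu hv => by
      rw [adj_rect_iff] at h ⊢
      exact ⟨h.1, (hmo u).2 ⟨h.2.1, hu⟩, (hmo v).2 ⟨h.2.2, hv⟩⟩)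
    (fun u v h => ((hmo v).1 (adj_rect_iff.1 h).2.2).2)
    ((hmo _).1 ha).2 ((hmo _).1 hp0).2 ((hmo _).1 hp1).2 ((hmo _).1 hp3).2
    h33 h22 hm23 h01 h00 h11 hm21 hN0 hN1 hN2 hN3 hm02 hm03 hm13

end Summit.CriticalPhenomena.SAWScalingLimit.Theorems.BoundaryTP2
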